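import Mathlib.Analysis.SpecialFunctions.Pow.Asymptotics
import Mathlib.Analysis.SpecialFunctions.Pow.Real
import Mathlib.Analysis.SpecialFunctions.Log.Base
import Mathlib.Algebra.Polynomial.Eval.Defs
import Mathlib.Data.Nat.Sqrt
import Mathlib.Data.Nat.Log
import Mathlib.Order.Filter.AtTopBot.Basic
import Literature.Computability.Complexity.Classes
import HarnessLib

/-!
# Scales for the nondeterministic simulation of `MA` (arithmetic toolkit for IKW 2002, Thm. 12)

Literature / complexity toolkit, pure arithmetic. In the proof of Impagliazzo–Kabanets–Wigderson's
Theorem 12 (`IKWGenerators.lean`: a `poly(2ⁿ)`-time nondeterministic generator of hard `2ⁿ`-bit truth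
tables with advice `a(n)` gives `MA ⊆ io-[NTIME(2^{N^ε})/a(N^ε)]` for every `ε > 0`) the simulating
machine, on inputs of length `N`, runs the generator at a TABLE SCALE `m = m(N)` and the
pseudorandom generator of Theorem 11 at an output length `n(N) = poly(N)` with `c·m²` seed bits;
everything costs `poly(2^{O(m²)} + N)` steps, the tables must be hard for size `(n(N) + m)^c`, and
the infinitely many hard scales of the generator must be met by infinitely many input lengths.
The printed proof takes `m = N^δ`; a machine has to COMPUTE its scale, and the tree's `FP` toolkit
offers the integer square root (`IsqrtBrick.lean`), so the scale used is the iterated integer square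
root `m(N) = ⌊√⌊√⋯N⋯⌋⌋ = Nat.sqrt^[j] N` (`= ⌊N^{2^{-j}}⌋`). This file proves the facts about it that
the simulation needs:

* `iterate_sqrt_pow_le`, `lt_succ_iterate_sqrt_pow` (`m^{2^j} ≤ N < (m+1)^{2^j}`),
  `monotone_iterate_sqrt`, `iterate_sqrt_pow_self` / `surjective_iterate_sqrt`,
  `tendsto_iterate_sqrt`, `iterate_sqrt_le_rpow` (`m ≤ N^{2^{-j}}`), `iterate_sqrt_le_ceil_rpow`
  (`m(N) ≤ ⌈N^ε⌉₊` once `2^{-j} ≤ ε`: the advice `a(m(N))` is within `a(⌈N^ε⌉₊)` for monotone `a`);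
* `frequently_comp_of_monotone_surjective` — infinitely many hard scales `m` are met by infinitely
  many lengths `N` (the `io` bookkeeping of Thm. 12 (2));
* `exists_pow_le_iterate_sqrt_pow` — for a polynomial `Q` and exponents `j, c` some `d` has
  `(Q(N) + m)^c ≤ m^d` for all large `N` (superpolynomial hardness `> m^d` at scale `m` beats the
  polynomial threshold of Theorem 11 at output length `Q(N)`);
* `eventually_cost_le_two_pow_ceil_rpow` — `c₂ (2^{A m²} + M)^{c₂} + c₂ ≤ 2^{⌈M^ε⌉₊}` for all large
  `M` once `2 · 2^{-j} < ε` (the cost of the simulation is within the budget of `NTIME(2^{N^ε})`);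
  the same for a general seed exponent `p` (`eventually_linear_scale_pow_le_ceil_rpow`,
  `eventually_cost_pow_le_two_pow_ceil_rpow`: `A m^p`, condition `p · 2^{-j} < ε`; `exists_root_depth`
  picks such a `j`), and `exists_const_of_eventually_le` (one constant for all lengths, the shape
  `c · t(n) + c` of the tree's `NTIME`);
* the gap arithmetic of the majority vote: `half_lt_of_abs_sub_le`, `lt_half_of_abs_sub_le`
  (a `2/3`–`1/3` gap survives an error `< 1/6`), `one_div_lt_one_sixth` (`1/n < 1/6` from `n = 7` on),
  `two_pow_lt_two_mul_iff` (`2^k < 2·a ↔ 1/2 < a/2^k`).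

Everything is proved; no definitions (the scale is written `Nat.sqrt^[j]`). Mathlib: `Nat.sqrt`,
`Nat.log`, `Real.rpow`, `Real.isLittleO_log_rpow_atTop`, `tendsto_rpow_atTop`; nothing of the tree is
duplicated (searched `Nat.sqrt^[`, `iterate_sqrt`, `ceil_rpow`: none).

## References

* R. Impagliazzo, V. Kabanets, A. Wigderson, *In search of an easy witness: exponential time vs.
  probabilistic polynomial time*, JCSS 65 (2002) 672–694, Thm. 12 and the paragraph before it
  (the scales `n^δ`, `n^ε`, time `2^{n^ε}`) [ImpagliazzoKabanetsWigderson2002].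
* S. Arora, B. Barak, *Computational Complexity: A Modern Approach*, CUP 2009, proof of Lemma 20.3
  (majority vote over all seeds; the `2/3`–`1/3` gap) [AroraBarakCC2009].
-/

noncomputable section

namespace Literature.Computability.Complexity

open Filter Real

/-! ### The iterated integer square root `Nat.sqrt^[j] N = ⌊N^{2^{-j}}⌋` -/

/-- `(Nat.sqrt^[j] N)^{2^j} ≤ N`. [folklore] -/
theorem iterate_sqrt_pow_le (j N : ℕ) : (Nat.sqrt^[j] N) ^ 2 ^ j ≤ N := by
  induction j generalizing N with
  | zero => simp
  | succ j ih =>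
    rw [Function.iterate_succ_apply, pow_succ, pow_mul]
    exact (Nat.pow_le_pow_left (ih (Nat.sqrt N)) 2).trans (Nat.sqrt_le' N)

/-- `N < (Nat.sqrt^[j] N + 1)^{2^j}`. [folklore] -/
theorem lt_succ_iterate_sqrt_pow (j N : ℕ) : N < (Nat.sqrt^[j] N + 1) ^ 2 ^ j := by
  induction j generalizing N with
  | zero => simp
  | succ j ih =>
    rw [Function.iterate_succ_apply, pow_succ, pow_mul]
    have h1 : N < (Nat.sqrt N + 1) ^ 2 := Nat.lt_succ_sqrt' N
    have h2 : Nat.sqrt N + 1 ≤ (Nat.sqrt^[j] (Nat.sqrt N) + 1) ^ 2 ^ j := ih (Nat.sqrt N)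
    exact h1.trans_le (Nat.pow_le_pow_left h2 2)

/-- The iterated square root is monotone. [folklore] -/
theorem monotone_iterate_sqrt (j : ℕ) : Monotone (Nat.sqrt^[j]) :=
  Monotone.iterate (fun _ _ h => Nat.sqrt_le_sqrt h) j

/-- `Nat.sqrt^[j] (m^{2^j}) = m`. [folklore] -/
theorem iterate_sqrt_pow_self (j m : ℕ) : Nat.sqrt^[j] (m ^ 2 ^ j) = m := by
  induction j with
  | zero => simp
  | succ j ih => rw [Function.iterate_succ_apply, pow_succ, pow_mul, Nat.sqrt_eq', ih]

/-- The iterated square root is surjective. [folklore] -/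
theorem surjective_iterate_sqrt (j : ℕ) : Function.Surjective (Nat.sqrt^[j]) :=
  fun m => ⟨m ^ 2 ^ j, iterate_sqrt_pow_self j m⟩

/-- The iterated square root tends to infinity. [folklore] -/
theorem tendsto_iterate_sqrt (j : ℕ) : Tendsto (Nat.sqrt^[j]) atTop atTop :=
  (monotone_iterate_sqrt j).tendsto_atTop_atTop fun b => ⟨b ^ 2 ^ j, (iterate_sqrt_pow_self j b).ge⟩

/-- `Nat.sqrt^[j] N ≤ N`. [folklore] -/
theorem iterate_sqrt_le_self (j N : ℕ) : Nat.sqrt^[j] N ≤ N := by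
  induction j generalizing N with
  | zero => simp
  | succ j ih => rw [Function.iterate_succ_apply]; exact (ih _).trans (Nat.sqrt_le_self N)

/-- `Nat.sqrt^[j] N ≤ N^{2^{-j}}` as real numbers. [folklore] -/
theorem iterate_sqrt_le_rpow (j N : ℕ) : (Nat.sqrt^[j] N : ℝ) ≤ (N : ℝ) ^ ((1 / 2 : ℝ) ^ j) := by
  have hpow : ((Nat.sqrt^[j] N : ℝ)) ^ (2 ^ j : ℕ) ≤ (N : ℝ) := by
    exact_mod_cast iterate_sqrt_pow_le j N
  have h0 : (0 : ℝ) ≤ Nat.sqrt^[j] N := Nat.cast_nonneg _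
  have hinv : ((1 / 2 : ℝ) ^ j) = ((2 ^ j : ℕ) : ℝ)⁻¹ := by
    rw [Nat.cast_pow, Nat.cast_ofNat, one_div, inv_pow]
  rw [hinv]
  have hne : (2 ^ j : ℕ) ≠ 0 := pow_ne_zero j two_ne_zero
  calc (Nat.sqrt^[j] N : ℝ) = (((Nat.sqrt^[j] N : ℝ)) ^ (2 ^ j : ℕ)) ^ (((2 ^ j : ℕ) : ℝ)⁻¹) :=
        (Real.pow_rpow_inv_natCast h0 hne).symm
    _ ≤ (N : ℝ) ^ (((2 ^ j : ℕ) : ℝ)⁻¹) :=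
        Real.rpow_le_rpow (pow_nonneg h0 _) hpow (inv_nonneg.2 (Nat.cast_nonneg _))

/-- `Nat.sqrt^[j] N ≤ ⌈N^ε⌉₊` once `2^{-j} ≤ ε` (so that for a monotone advice bound `a`, the advice
`a(m(N))` used at length `N` is within `a(⌈N^ε⌉₊)`). [folklore] -/
theorem iterate_sqrt_le_ceil_rpow {j : ℕ} {ε : ℝ} (hε : (1 / 2 : ℝ) ^ j ≤ ε) (N : ℕ) :
    Nat.sqrt^[j] N ≤ ⌈(N : ℝ) ^ ε⌉₊ := by
  rcases Nat.eq_zero_or_pos N with rfl | hN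
  · have : Nat.sqrt^[j] 0 ≤ 0 := iterate_sqrt_le_self j 0
    omega
  · have h1 : (1 : ℝ) ≤ N := by exact_mod_cast hN
    have h := (iterate_sqrt_le_rpow j N).trans (Real.rpow_le_rpow_of_exponent_le h1 hε)
    exact_mod_cast h.trans (Nat.le_ceil _)

/-! ### Meeting infinitely many scales -/

/-- **Infinitely many scales are met**: along a monotone surjection `f : ℕ → ℕ` every property holding
for infinitely many `m` holds for infinitely many `f N`. [folklore] -/
theorem frequently_comp_of_monotone_surjective {f : ℕ → ℕ} (hm : Monotone f)
    (hs : Function.Surjective f) {P : ℕ → Prop} (h : ∃ᶠ m in atTop, P m) :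
    ∃ᶠ N in atTop, P (f N) := by
  rw [frequently_atTop] at h ⊢
  intro a
  obtain ⟨m, hm', hPm⟩ := h (f a + 1)
  obtain ⟨N, rfl⟩ := hs m
  refine ⟨N, ?_, hPm⟩
  by_contra hlt
  exact absurd (hm (not_le.1 hlt).le) (by omega)

/-! ### A polynomial threshold is below a power of the scale -/

/-- **Superpolynomial hardness at the scale beats a polynomial threshold**: for a polynomial `Q` and
exponents `j`, `c` there is `d` with `(Q(N) + m)^c ≤ m^d` for all large `N`, `m = Nat.sqrt^[j] N`
(since `N < (m+1)^{2^j}`, `Q(N) + m` is polynomial in `m`). [folklore] -/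
theorem exists_pow_le_iterate_sqrt_pow (Q : Polynomial ℕ) (j c : ℕ) :
    ∃ d : ℕ, ∀ᶠ N in atTop, (Q.eval N + Nat.sqrt^[j] N) ^ c ≤ (Nat.sqrt^[j] N) ^ d := by
  obtain ⟨A, k, hAk⟩ := exists_eval_le_mul_pow_add Q
  -- `Q(N) + m ≤ B · m^{Jk+1}` with `J = 2^j`, `B = 2A·2^{Jk} + 1`, for `m ≥ 1`
  set J := 2 ^ j with hJ
  set B := 2 * A * 2 ^ (J * k) + 1 with hB
  refine ⟨c * (J * k + 1) + c, ?_⟩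
  filter_upwards [(tendsto_iterate_sqrt j).eventually_ge_atTop (max B 1)] with N hN
  set m := Nat.sqrt^[j] N with hm
  have hm1 : 1 ≤ m := le_of_max_le_right hN
  have hmB : B ≤ m := le_of_max_le_left hN
  have hNlt : N < (m + 1) ^ J := lt_succ_iterate_sqrt_pow j N
  have h2m : m + 1 ≤ 2 * m := by omega
  have hN' : N ≤ 2 ^ J * m ^ J := by
    have := Nat.pow_le_pow_left h2m J
    rw [mul_pow] at this
    omega
  have hQ : Q.eval N ≤ 2 * A * 2 ^ (J * k) * m ^ (J * k) := by
    refine (hAk N).trans ?_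
    have h1 : N ^ k ≤ (2 ^ J * m ^ J) ^ k := Nat.pow_le_pow_left hN' k
    rw [mul_pow, ← pow_mul, ← pow_mul] at h1
    have h2 : 1 ≤ 2 ^ (J * k) * m ^ (J * k) := Nat.one_le_iff_ne_zero.2 (by positivity)
    nlinarith
  have hsum : Q.eval N + m ≤ B * m ^ (J * k + 1) := by
    have hp1 : 1 ≤ m ^ (J * k) := Nat.one_le_iff_ne_zero.2 (by positivity)
    have h3 : m ^ (J * k) ≤ m ^ (J * k) * m := by
      calc m ^ (J * k) = m ^ (J * k) * 1 := (mul_one _).symm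
        _ ≤ m ^ (J * k) * m := Nat.mul_le_mul_left _ hm1
    have h5 : 2 * A * 2 ^ (J * k) * m ^ (J * k) ≤ 2 * A * 2 ^ (J * k) * (m ^ (J * k) * m) :=
      Nat.mul_le_mul_left _ h3
    have h6 : m ≤ 1 * (m ^ (J * k) * m) := by
      rw [one_mul]
      calc m = 1 * m := (one_mul m).symm
        _ ≤ m ^ (J * k) * m := Nat.mul_le_mul_right _ hp1
    rw [hB, pow_succ, add_mul]
    exact Nat.add_le_add (hQ.trans h5) h6
  calc (Q.eval N + m) ^ c ≤ (B * m ^ (J * k + 1)) ^ c := Nat.pow_le_pow_left hsum c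
    _ = B ^ c * m ^ (c * (J * k + 1)) := by rw [mul_pow, ← pow_mul, mul_comm (J * k + 1)]
    _ ≤ m ^ c * m ^ (c * (J * k + 1)) := Nat.mul_le_mul_right _ (Nat.pow_le_pow_left hmB c)
    _ = m ^ (c * (J * k + 1) + c) := by rw [← pow_add, add_comm]

/-! ### The cost of the simulation is within `2^{⌈M^ε⌉₊}` -/

/-- `2^a + 2^b ≤ 2^{a+b+1}`. [folklore] -/
private theorem two_pow_add_two_pow_le_succ (a b : ℕ) : 2 ^ a + 2 ^ b ≤ 2 ^ (a + b + 1) := by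
  have ha : 2 ^ a ≤ 2 ^ (a + b) := Nat.pow_le_pow_right (by norm_num) (by omega)
  have hb : 2 ^ b ≤ 2 ^ (a + b) := Nat.pow_le_pow_right (by norm_num) (by omega)
  rw [pow_succ]
  omega

/-- The cost `c₂ (2^{E} + M)^{c₂} + c₂` is a power of two of a LINEAR combination of `E` and `log₂ M`:
`≤ 2^{c₂ (E + log₂ M + 2) + c₂ + 1}`. [folklore] -/
theorem cost_le_two_pow (c₂ E M : ℕ) :
    c₂ * (2 ^ E + M) ^ c₂ + c₂ ≤ 2 ^ (c₂ * (E + Nat.log 2 M + 2) + c₂ + 1) := by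
  have hM : M < 2 ^ (Nat.log 2 M + 1) := Nat.lt_pow_succ_log_self (by norm_num) M
  have hbase : 2 ^ E + M ≤ 2 ^ (E + Nat.log 2 M + 2) := by
    have := two_pow_add_two_pow_le_succ E (Nat.log 2 M + 1)
    have e : E + (Nat.log 2 M + 1) + 1 = E + Nat.log 2 M + 2 := by omega
    rw [e] at this
    omega
  have hpow : (2 ^ E + M) ^ c₂ ≤ 2 ^ (c₂ * (E + Nat.log 2 M + 2)) := by
    rw [mul_comm, pow_mul]
    exact Nat.pow_le_pow_left hbase c₂
  have hc : c₂ ≤ 2 ^ c₂ := Nat.lt_two_pow_self.le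
  set X := 2 ^ (c₂ * (E + Nat.log 2 M + 2)) with hX
  have hX1 : 1 ≤ X := Nat.one_le_two_pow
  calc c₂ * (2 ^ E + M) ^ c₂ + c₂ ≤ 2 ^ c₂ * X + 2 ^ c₂ * X := by
        have := Nat.mul_le_mul hc hpow
        nlinarith
    _ = 2 ^ (c₂ * (E + Nat.log 2 M + 2) + c₂ + 1) := by rw [hX]; ring

/-- **The real-analysis punchline**: `a · M^{2θ} + b · log₂ M + c ≤ M^ε` for all large `M` once
`2θ < ε` (`M^{2θ} = o(M^ε)`, `log M = o(M^ε)`), in the integer form with the scale `Nat.sqrt^[j] M`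
(`θ = 2^{-j}`) and `Nat.log 2`. [folklore] -/
theorem eventually_linear_scale_le_ceil_rpow (a b c j : ℕ) {ε : ℝ} (hε : 2 * (1 / 2 : ℝ) ^ j < ε) :
    ∀ᶠ M : ℕ in atTop, a * (Nat.sqrt^[j] M) ^ 2 + b * Nat.log 2 M + c ≤ ⌈(M : ℝ) ^ ε⌉₊ := by
  set θ : ℝ := (1 / 2 : ℝ) ^ j with hθ
  have hθ0 : 0 < θ := by positivity
  have hεpos : 0 < ε := lt_of_le_of_lt (by positivity) hε
  have hgap : 0 < ε - 2 * θ := by linarith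
  -- (1) `a M^{2θ} ≤ M^ε / 3` eventually: `3a ≤ M^{ε - 2θ}`
  have h1 : ∀ᶠ x : ℝ in atTop, 3 * a * x ^ (2 * θ) ≤ x ^ ε / 3 ∧ 1 ≤ x := by
    filter_upwards [(tendsto_rpow_atTop hgap).eventually_ge_atTop (9 * (a : ℝ)),
      eventually_ge_atTop (1 : ℝ)] with x hx hx1
    refine ⟨?_, hx1⟩
    have hx0 : 0 < x := by linarith
    have e : x ^ ε = x ^ (2 * θ) * x ^ (ε - 2 * θ) := by
      rw [← Real.rpow_add hx0]; congr 1; ring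
    rw [e]
    have hp : 0 ≤ x ^ (2 * θ) := by positivity
    nlinarith
  -- (2) `b log M ≤ (log 2) M^ε / 3` eventually (`log = o(x^ε)`)
  have hl2 : 0 < Real.log 2 := Real.log_pos one_lt_two
  have h2 : ∀ᶠ x : ℝ in atTop, (b : ℝ) * Real.log x ≤ Real.log 2 * x ^ ε / 3 := by
    have ho := (isLittleO_log_rpow_atTop hεpos).def (c := Real.log 2 / (3 * (b + 1))) (by positivity)
    filter_upwards [ho, eventually_ge_atTop (1 : ℝ)] with x hx hx1
    rw [Real.norm_eq_abs, Real.norm_eq_abs, abs_of_nonneg (Real.log_nonneg hx1),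
      abs_of_nonneg (by positivity)] at hx
    have hb : (b : ℝ) ≤ b + 1 := by linarith
    have hlog : 0 ≤ Real.log x := Real.log_nonneg hx1
    calc (b : ℝ) * Real.log x ≤ (b + 1) * Real.log x := by nlinarith
      _ ≤ (b + 1) * (Real.log 2 / (3 * (b + 1)) * x ^ ε) := by
          exact mul_le_mul_of_nonneg_left hx (by positivity)
      _ = Real.log 2 * x ^ ε / 3 := by field_simp
  -- (3) the constant `c + …` is `≤ M^ε / 3` eventually
  have h3 : ∀ᶠ x : ℝ in atTop, ((c : ℝ) + 1) ≤ x ^ ε / 3 :=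
    ((tendsto_rpow_atTop hεpos).eventually_ge_atTop (3 * ((c : ℝ) + 1))).mono fun x hx => by
      linarith
  have hnat := tendsto_natCast_atTop_atTop.eventually (h1.and (h2.and h3))
  filter_upwards [hnat] with M hM
  obtain ⟨⟨hM1, hMge⟩, hM2, hM3⟩ := hM
  -- integer pieces bounded by the real ones
  set m := Nat.sqrt^[j] M with hm
  have hmR : (m : ℝ) ≤ (M : ℝ) ^ θ := iterate_sqrt_le_rpow j M
  have hm2 : ((m : ℝ)) ^ 2 ≤ (M : ℝ) ^ (2 * θ) := by
    have h0 : (0 : ℝ) ≤ m := Nat.cast_nonneg _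
    have hM0 : (0 : ℝ) ≤ M := Nat.cast_nonneg _
    calc ((m : ℝ)) ^ 2 ≤ ((M : ℝ) ^ θ) ^ 2 := pow_le_pow_left₀ h0 hmR 2
      _ = (M : ℝ) ^ (2 * θ) := by
          rw [← Real.rpow_natCast, ← Real.rpow_mul hM0]; norm_num; ring_nf
  have hlog : (Nat.log 2 M : ℝ) * Real.log 2 ≤ Real.log M := by
    have hMpos : 0 < M := by exact_mod_cast (show (1 : ℝ) ≤ M from hMge)
    have hp : ((2 ^ Nat.log 2 M : ℕ) : ℝ) ≤ M := by exact_mod_cast Nat.pow_log_le_self 2 hMpos.ne'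
    have h2p : (0 : ℝ) < (2 ^ Nat.log 2 M : ℕ) := by positivity
    have := Real.log_le_log h2p hp
    rwa [Nat.cast_pow, Nat.cast_ofNat, Real.log_pow] at this
  have hreal : (a : ℝ) * (m : ℝ) ^ 2 + b * (Nat.log 2 M : ℝ) + c ≤ (M : ℝ) ^ ε := by
    have hb0 : (0 : ℝ) ≤ b := Nat.cast_nonneg _
    have ha0 : (0 : ℝ) ≤ a := Nat.cast_nonneg _
    have t1 : (a : ℝ) * (m : ℝ) ^ 2 ≤ (M : ℝ) ^ ε / 3 := by nlinarith
    have t2 : (b : ℝ) * (Nat.log 2 M : ℝ) ≤ (M : ℝ) ^ ε / 3 := by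
      have : (b : ℝ) * ((Nat.log 2 M : ℝ) * Real.log 2) ≤ Real.log 2 * (M : ℝ) ^ ε / 3 := by
        calc (b : ℝ) * ((Nat.log 2 M : ℝ) * Real.log 2) ≤ b * Real.log M :=
              mul_le_mul_of_nonneg_left hlog hb0
          _ ≤ Real.log 2 * (M : ℝ) ^ ε / 3 := hM2
      have e : (b : ℝ) * ((Nat.log 2 M : ℝ) * Real.log 2) = Real.log 2 * (b * Nat.log 2 M) := by ring
      rw [e, mul_div_assoc] at this
      exact le_of_mul_le_mul_left this hl2
    linarith
  have hceil : ((a * m ^ 2 + b * Nat.log 2 M + c : ℕ) : ℝ) ≤ ⌈(M : ℝ) ^ ε⌉₊ := by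
    push_cast
    exact hreal.trans (Nat.le_ceil _)
  exact_mod_cast hceil

/-- **The cost of the simulation is within the budget**: `c₂ (2^{A m²} + M)^{c₂} + c₂ ≤ 2^{⌈M^ε⌉₊}` for
all large `M`, `m = Nat.sqrt^[j] M`, once `2 · 2^{-j} < ε`. [folklore] -/
theorem eventually_cost_le_two_pow_ceil_rpow (c₂ A j : ℕ) {ε : ℝ} (hε : 2 * (1 / 2 : ℝ) ^ j < ε) :
    ∀ᶠ M : ℕ in atTop,
      c₂ * (2 ^ (A * (Nat.sqrt^[j] M) ^ 2) + M) ^ c₂ + c₂ ≤ 2 ^ ⌈(M : ℝ) ^ ε⌉₊ := by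
  filter_upwards [eventually_linear_scale_le_ceil_rpow (c₂ * A) c₂ (3 * c₂ + 1) j hε] with M hM
  refine (cost_le_two_pow c₂ _ M).trans (Nat.pow_le_pow_right (by norm_num) ?_)
  have e : c₂ * (A * (Nat.sqrt^[j] M) ^ 2 + Nat.log 2 M + 2) + c₂ + 1 =
      c₂ * A * (Nat.sqrt^[j] M) ^ 2 + c₂ * Nat.log 2 M + (3 * c₂ + 1) := by ring
  rw [e]
  exact hM

/-- **The real-analysis punchline, general seed exponent**: `a · m^p + b · log₂ M + c ≤ ⌈M^ε⌉₊` for all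
large `M`, `m = Nat.sqrt^[j] M`, once `p · 2^{-j} < ε` (`m^p ≤ M^{pθ}`, `θ = 2^{-j}`, and
`M^{pθ}, log M = o(M^ε)`). [folklore] -/
theorem eventually_linear_scale_pow_le_ceil_rpow (a b c p j : ℕ) {ε : ℝ} (hε : p * (1 / 2 : ℝ) ^ j < ε) :
    ∀ᶠ M : ℕ in atTop, a * (Nat.sqrt^[j] M) ^ p + b * Nat.log 2 M + c ≤ ⌈(M : ℝ) ^ ε⌉₊ := by
  set θ : ℝ := (1 / 2 : ℝ) ^ j with hθ
  have hθ0 : 0 < θ := by positivity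
  have hεpos : 0 < ε := lt_of_le_of_lt (by positivity) hε
  have hgap : 0 < ε - p * θ := by linarith
  -- (1) `a M^{pθ} ≤ M^ε / 3` eventually: `3a ≤ M^{ε - pθ}`
  have h1 : ∀ᶠ x : ℝ in atTop, 3 * a * x ^ (p * θ) ≤ x ^ ε / 3 ∧ 1 ≤ x := by
    filter_upwards [(tendsto_rpow_atTop hgap).eventually_ge_atTop (9 * (a : ℝ)),
      eventually_ge_atTop (1 : ℝ)] with x hx hx1
    refine ⟨?_, hx1⟩
    have hx0 : 0 < x := by linarith
    have e : x ^ ε = x ^ (p * θ) * x ^ (ε - p * θ) := by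
      rw [← Real.rpow_add hx0]; congr 1; ring
    rw [e]
    have hp : 0 ≤ x ^ (p * θ) := by positivity
    nlinarith
  -- (2) `b log M ≤ (log 2) M^ε / 3` eventually (`log = o(x^ε)`)
  have hl2 : 0 < Real.log 2 := Real.log_pos one_lt_two
  have h2 : ∀ᶠ x : ℝ in atTop, (b : ℝ) * Real.log x ≤ Real.log 2 * x ^ ε / 3 := by
    have ho := (isLittleO_log_rpow_atTop hεpos).def (c := Real.log 2 / (3 * (b + 1))) (by positivity)
    filter_upwards [ho, eventually_ge_atTop (1 : ℝ)] with x hx hx1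
    rw [Real.norm_eq_abs, Real.norm_eq_abs, abs_of_nonneg (Real.log_nonneg hx1),
      abs_of_nonneg (by positivity)] at hx
    have hlog : 0 ≤ Real.log x := Real.log_nonneg hx1
    calc (b : ℝ) * Real.log x ≤ (b + 1) * Real.log x := by nlinarith
      _ ≤ (b + 1) * (Real.log 2 / (3 * (b + 1)) * x ^ ε) := by
          exact mul_le_mul_of_nonneg_left hx (by positivity)
      _ = Real.log 2 * x ^ ε / 3 := by field_simp
  -- (3) the constant
  have h3 : ∀ᶠ x : ℝ in atTop, ((c : ℝ) + 1) ≤ x ^ ε / 3 :=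
    ((tendsto_rpow_atTop hεpos).eventually_ge_atTop (3 * ((c : ℝ) + 1))).mono fun x hx => by
      linarith
  have hnat := tendsto_natCast_atTop_atTop.eventually (h1.and (h2.and h3))
  filter_upwards [hnat] with M hM
  obtain ⟨⟨hM1, hMge⟩, hM2, hM3⟩ := hM
  set m := Nat.sqrt^[j] M with hm
  have hmR : (m : ℝ) ≤ (M : ℝ) ^ θ := iterate_sqrt_le_rpow j M
  have hmp : ((m : ℝ)) ^ p ≤ (M : ℝ) ^ (p * θ) := by
    have h0 : (0 : ℝ) ≤ m := Nat.cast_nonneg _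
    have hM0 : (0 : ℝ) ≤ M := Nat.cast_nonneg _
    calc ((m : ℝ)) ^ p ≤ ((M : ℝ) ^ θ) ^ p := pow_le_pow_left₀ h0 hmR p
      _ = (M : ℝ) ^ (p * θ) := by
          rw [← Real.rpow_natCast, ← Real.rpow_mul hM0, mul_comm]
  have hlog : (Nat.log 2 M : ℝ) * Real.log 2 ≤ Real.log M := by
    have hMpos : 0 < M := by exact_mod_cast (show (1 : ℝ) ≤ M from hMge)
    have hp2 : ((2 ^ Nat.log 2 M : ℕ) : ℝ) ≤ M := by exact_mod_cast Nat.pow_log_le_self 2 hMpos.ne'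
    have h2p : (0 : ℝ) < (2 ^ Nat.log 2 M : ℕ) := by positivity
    have := Real.log_le_log h2p hp2
    rwa [Nat.cast_pow, Nat.cast_ofNat, Real.log_pow] at this
  have hreal : (a : ℝ) * (m : ℝ) ^ p + b * (Nat.log 2 M : ℝ) + c ≤ (M : ℝ) ^ ε := by
    have hb0 : (0 : ℝ) ≤ b := Nat.cast_nonneg _
    have ha0 : (0 : ℝ) ≤ a := Nat.cast_nonneg _
    have t1 : (a : ℝ) * (m : ℝ) ^ p ≤ (M : ℝ) ^ ε / 3 := by nlinarith
    have t2 : (b : ℝ) * (Nat.log 2 M : ℝ) ≤ (M : ℝ) ^ ε / 3 := by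
      have : (b : ℝ) * ((Nat.log 2 M : ℝ) * Real.log 2) ≤ Real.log 2 * (M : ℝ) ^ ε / 3 := by
        calc (b : ℝ) * ((Nat.log 2 M : ℝ) * Real.log 2) ≤ b * Real.log M :=
              mul_le_mul_of_nonneg_left hlog hb0
          _ ≤ Real.log 2 * (M : ℝ) ^ ε / 3 := hM2
      have e : (b : ℝ) * ((Nat.log 2 M : ℝ) * Real.log 2) = Real.log 2 * (b * Nat.log 2 M) := by ring
      rw [e, mul_div_assoc] at this
      exact le_of_mul_le_mul_left this hl2
    linarith
  have hceil : ((a * m ^ p + b * Nat.log 2 M + c : ℕ) : ℝ) ≤ ⌈(M : ℝ) ^ ε⌉₊ := by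
    push_cast
    exact hreal.trans (Nat.le_ceil _)
  exact_mod_cast hceil

/-- **The cost of the simulation is within the budget, general seed exponent**:
`c₂ (2^{A m^p} + M)^{c₂} + c₂ ≤ 2^{⌈M^ε⌉₊}` for all large `M`, `m = Nat.sqrt^[j] M`, once `p · 2^{-j} < ε`.
[folklore] -/
theorem eventually_cost_pow_le_two_pow_ceil_rpow (c₂ A p j : ℕ) {ε : ℝ} (hε : p * (1 / 2 : ℝ) ^ j < ε) :
    ∀ᶠ M : ℕ in atTop,
      c₂ * (2 ^ (A * (Nat.sqrt^[j] M) ^ p) + M) ^ c₂ + c₂ ≤ 2 ^ ⌈(M : ℝ) ^ ε⌉₊ := by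
  filter_upwards [eventually_linear_scale_pow_le_ceil_rpow (c₂ * A) c₂ (3 * c₂ + 1) p j hε] with M hM
  refine (cost_le_two_pow c₂ _ M).trans (Nat.pow_le_pow_right (by norm_num) ?_)
  have e : c₂ * (A * (Nat.sqrt^[j] M) ^ p + Nat.log 2 M + 2) + c₂ + 1 =
      c₂ * A * (Nat.sqrt^[j] M) ^ p + c₂ * Nat.log 2 M + (3 * c₂ + 1) := by ring
  rw [e]
  exact hM

/-- For every exponent `p` and `ε > 0` some root depth `j` has `p · 2^{-j} < ε`. [folklore] -/
theorem exists_root_depth (p : ℕ) {ε : ℝ} (hε : 0 < ε) : ∃ j : ℕ, p * (1 / 2 : ℝ) ^ j < ε := by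
  obtain ⟨j, hj⟩ := exists_pow_lt_of_lt_one (div_pos hε (by positivity : (0 : ℝ) < p + 1))
    (by norm_num : (1 / 2 : ℝ) < 1)
  refine ⟨j, ?_⟩
  have hp : (0 : ℝ) ≤ p := Nat.cast_nonneg _
  have h0 : (0 : ℝ) ≤ (1 / 2 : ℝ) ^ j := by positivity
  calc (p : ℝ) * (1 / 2 : ℝ) ^ j ≤ (p + 1) * (1 / 2 : ℝ) ^ j := by nlinarith
    _ < (p + 1) * (ε / (p + 1)) := by exact mul_lt_mul_of_pos_left hj (by positivity)
    _ = ε := by field_simp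

/-- **One constant for all lengths**: an eventual bound `T ≤ t` becomes `T ≤ c · t + c` everywhere
(the finitely many exceptions are absorbed in `c`), the shape of the tree's `NTIME`/`DTIME` bounds.
[folklore] -/
theorem exists_const_of_eventually_le {T t : ℕ → ℕ} (h : ∀ᶠ M in atTop, T M ≤ t M) :
    ∃ c : ℕ, ∀ M, T M ≤ c * t M + c := by
  obtain ⟨M₀, hM₀⟩ := eventually_atTop.1 h
  refine ⟨(Finset.range M₀).sup T + 1, fun M => ?_⟩
  by_cases hM : M₀ ≤ M
  · have := hM₀ M hM
    nlinarith [Nat.zero_le ((Finset.range M₀).sup T * t M)]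
  · have hlt : M < M₀ := not_le.1 hM
    have : T M ≤ (Finset.range M₀).sup T := Finset.le_sup (Finset.mem_range.2 hlt)
    nlinarith [Nat.zero_le (((Finset.range M₀).sup T + 1) * t M)]

/-! ### The gap arithmetic of the majority vote -/

/-- A `2/3` acceptance probability stays above `1/2` after an error `< 1/6`. [cite: AroraBarakCC2009, Lemma 20.3 (proof)] -/
theorem half_lt_of_abs_sub_le {p q e : ℝ} (h : |p - q| ≤ e) (hq : 2 / 3 ≤ q) (he : e < 1 / 6) :
    1 / 2 < p := by
  rw [abs_sub_le_iff] at h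
  linarith [h.2]

/-- A `1/3` acceptance probability stays below `1/2` after an error `< 1/6`. [cite: AroraBarakCC2009, Lemma 20.3 (proof)] -/
theorem lt_half_of_abs_sub_le {p q e : ℝ} (h : |p - q| ≤ e) (hq : q ≤ 1 / 3) (he : e < 1 / 6) :
    p < 1 / 2 := by
  rw [abs_sub_le_iff] at h
  linarith [h.1]

/-- `1/n < 1/6` from `n = 7` on (the error of a `SIZE(n)`-pseudorandom generator). [folklore] -/
theorem one_div_lt_one_sixth {n : ℕ} (hn : 7 ≤ n) : 1 / (n : ℝ) < 1 / 6 := by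
  have : (7 : ℝ) ≤ n := by exact_mod_cast hn
  rw [one_div_lt_one_div (by linarith) (by norm_num)]
  linarith

/-- The majority test in integers: `2^k < 2·a ↔ 1/2 < a / 2^k`. [folklore] -/
theorem two_pow_lt_two_mul_iff (k a : ℕ) : 2 ^ k < 2 * a ↔ (1 / 2 : ℝ) < (a : ℝ) / 2 ^ k := by
  have h2k : (0 : ℝ) < 2 ^ k := by positivity
  rw [lt_div_iff₀ h2k]
  constructor
  · intro h
    have h' : ((2 ^ k : ℕ) : ℝ) < ((2 * a : ℕ) : ℝ) := by exact_mod_cast h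
    push_cast at h'
    linarith
  · intro h
    have h' : ((2 ^ k : ℕ) : ℝ) < ((2 * a : ℕ) : ℝ) := by push_cast; linarith
    exact_mod_cast h'

end Literature.Computability.Complexity

end
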